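import Literature.MathematicalPhysics.QuantumFieldTheory.Balaban1983to89.T3PrintedRegularMinimiser
import Summits.QuantumFields.YangMills.Theses.SmallFieldWidening
import Summits.QuantumFields.YangMills.Theses.UnitScaleTilt
import HarnessLib

/-!
# Route `SmallFieldWidening` — crux r2 `AllHeightsSmallTilt` (stmt-QuantumFields-22883) IS IMPLIED BY ROUTE `UnitScaleTilt`'S K1 AT ANY
# FREE TOP FRACTION: the descended two-run tilt at the comparison height restricts to the all-heights events for free
# (support file; width seat `ym-line-sfw-p2-w3` gen 2 of line `ym-line-sfw-p2`)

THE OBSERVATION.  Route `UnitScaleTilt`'s crux K1 is proved in the DENSITY currency at the comparison height `n = ⌊K/m⌋`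
(`T3CruxEstimates.HeightSandwichAt F γ b₀ p₀ m`, from its items K1aR-pr `MinimiserStabilityRegPr` stmt-QuantumFields-19200 and K1bR-pr
`FluctuationComparisonRegPr` stmt-QuantumFields-19201 by `T3PrintedRegularMinimiser.heightSandwich_unitTilt_of_regPr`), i.e. as a tilt
`(D_{n,K+1})_*(Gibbs_{K+1}|histGood (K+1) n) = C·e^{h}·(D_{n,K})_*(Gibbs_K|histGood K n)` between the two runs' Gibbs measures DESCENDED to the
`n`-th tower (`T3TiltDescent.isTilt_descendTo_of_sandwich_ae`).  The heights that the free top fraction leaves unconstrained — the `n`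
coarsest averaged fields — are FUNCTIONS OF THE DESCENDED FIELD: `avg^{K−n+i}_K U = avg^{i}_n (D_{n,K} U)` read through the level
identification ([Balaban1987RG1] (0.11) across the towers, `T3LevelShift.iterFrom_fieldShift`).  Hence the ALL-HEIGHTS event of run `K` is
`histGood K 0 = histGood K n ∩ D_{n,K}⁻¹(histGood n 0)` (§1: the all-heights event OF THE `n`-TH APPROXIMATION pulled back), the descended
restricted measures of the all-heights events are the RESTRICTIONS of the descended measures to the downstairs event `histGood n 0` (§2), a
tilt restricts to any measurable event with the same radius and constant (§3), and the `n` common free averagings cost nothing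
(`T3TiltDescent.isTilt_unitA_of_isTilt_descendTo`).  Therefore (§4):

* `isTilt_unitA_histGood_zero_of_descendedTilt` — a descended two-run tilt at ANY comparison height `n ≤ K` with `n` free top steps gives
  the unit-lattice tilt of the FULLY-CONSTRAINED laws with the same radius;
* `unitTiltAt_zero_of_heightSandwichAt` — **`HeightSandwichAt F γ b₀ p₀ m → UnitTiltAt F γ b₀ p₀ 0` for EVERY `m`** (same radii);
* `allHeightsSmallTilt_of_heightSandwichAt_any` — r2 under the route prefix from `HeightSandwichAt` at any (profile-dependent) `m`;
* `allHeightsSmallTilt_of_unitScaleTilt_regPr` — **r2 ⇐ UST's K1 pair BY NAME**: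
  `UnitScaleTilt.MinimiserStabilityRegPr → UnitScaleTilt.FluctuationComparisonRegPr → SmallFieldWidening.AllHeightsSmallTilt`.

CONSEQUENCE FOR THE LINE (honest): the `m = 0` corner costs NOTHING on the tilt side once K1 is known in Bałaban's density currency at some
free top fraction — r2 is downstream of route `UnitScaleTilt`'s K1 items (all profiles: the aside pair 19200 ∧ 19201; the deciding interior
variant K1b-INT stmt-QuantumFields-20520 carries a profile floor `(b₁, p₁)` and so gives r2's body only for profiles beyond it), exactly as r3
is downstream of its K2-L socket (p579220/p580267).  No summit statement is touched (rung R3 record; the Yang–Mills mass gap is not proved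
by this line); nothing of Bałaban's estimates is asserted — every declaration is measure theory about [Balaban1987RG1] (0.11) and
[Balaban1985UV3] (7).
-/

noncomputable section

open MeasureTheory Filter Topology
open scoped ENNReal
open Literature.MathematicalPhysics.QuantumFieldTheory
open Literature.MathematicalPhysics.QuantumFieldTheory.Balaban1983to89
open Literature.MathematicalPhysics.QuantumFieldTheory.Balaban1983to89.Missing
open Literature.MathematicalPhysics.QuantumFieldTheory.Balaban1983to89.T3ContinuumYM3Torus
open Literature.MathematicalPhysics.QuantumFieldTheory.Balaban1983to89.T3LevelShift
open Literature.MathematicalPhysics.QuantumFieldTheory.Balaban1983to89.T3UnitScaleTilt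
open Literature.MathematicalPhysics.QuantumFieldTheory.Balaban1983to89.T3UnitLawDensityEML
open Literature.MathematicalPhysics.QuantumFieldTheory.Balaban1983to89.T3TiltDescent
open Literature.MathematicalPhysics.QuantumFieldTheory.Balaban1983to89.T3CruxEstimates
open Literature.MathematicalPhysics.QuantumFieldTheory.Balaban1983to89.T3PrintedRegularMinimiser

namespace Summit.QuantumFields.YangMills.Theorems.AllHeightsSmallTilt

/-! ## §1 The all-heights event of run `K` = the `n`-free event ∩ the pulled-back all-heights event of the `n`-th approximation -/

section Events

variable (F : T3Family) {n K : ℕ} (hn : n ≤ K)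

/-- **THE FREE TOP HEIGHTS ARE FUNCTIONS OF THE DESCENDED FIELD**: the height-`(K−n+i)` averaged field of run `K` is the height-`i`
averaged field of the descended field `D_{n,K}U` read through the level identification, so their small-field events coincide:
`PlaqSmall δ (avg^{i}_n (D_{n,K}U)) ↔ PlaqSmall δ (avg^{K−n+i}_K U)` ([Balaban1987RG1] (0.11) `Ū^{k} = M^{k}(U)` across the towers).
[cite: Balaban1987RG1, (0.11) p.253] -/
theorem plaqSmall_iter_descendTo_iff (i : ℕ) (δ : ℝ) (U : GaugeField (F.P K) 0 (Matrix.specialUnitaryGroup (Fin 2) ℂ)) :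
    PlaqSmall δ (Averaging.iter (fun k => BlockAveraging.blockAvg (P := F.P n) (j := k) ℰp) i (descendTo F ℰp n K hn U)) ↔
      PlaqSmall δ (Averaging.iter (fun k => BlockAveraging.blockAvg (P := F.P K) (j := k) ℰp) (K - n + i) U) := by
  have e : T3LevelShift.fieldShift
        (F.sitesPerDir_eq (m := F.m) (K := n) (j := i) (m' := F.m) (K' := K) (j' := K - n + i) (by omega))
        (Averaging.iter (fun k => BlockAveraging.blockAvg (P := F.P K) (j := k) ℰp) (K - n + i) U) =
      Averaging.iter (fun k => BlockAveraging.blockAvg (P := F.P n) (j := k) ℰp) i (descendTo F ℰp n K hn U) := by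
    rw [T4AvgSensitivity.iter_add _ (K - n) i U]
    exact iterFrom_fieldShift ℰp (show F.m + K = F.m + n + (K - n) by omega) i _
  rw [← e]
  exact plaqSmall_fieldShift F _ δ _

/-- **`histGood K 0 ↔ histGood K n ∧ D_{n,K}U ∈ histGood n 0`**: the all-heights UV-small-history event of run `K` is the event with `n`
free top steps intersected with the pull-back of the ALL-HEIGHTS EVENT OF THE `n`-TH APPROXIMATION (same threshold profile `θ`: height
`K − n + i` of run `K` and height `i` of the `n`-th approximation both carry `θ(n − i)`). [cite: Balaban1985UV3, (7) p.257] -/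
theorem mem_histGood_zero_iff (θ : ℕ → ℝ) (U : GaugeField (F.P K) 0 (Matrix.specialUnitaryGroup (Fin 2) ℂ)) :
    U ∈ histGood F ℰp θ K 0 ↔ U ∈ histGood F ℰp θ K n ∧ descendTo F ℰp n K hn U ∈ histGood F ℰp θ n 0 := by
  constructor
  · intro hU
    refine ⟨fun j hj => hU j (by omega), fun i hi => ?_⟩
    have h := hU (K - n + i) (by omega)
    rw [show K - (K - n + i) = n - i by omega] at h
    exact (plaqSmall_iter_descendTo_iff F hn i _ U).mpr h
  · rintro ⟨hU, hD⟩ j hj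
    by_cases hjn : j + n ≤ K
    · exact hU j hjn
    · obtain ⟨i, rfl⟩ : ∃ i, j = K - n + i := ⟨j - (K - n), by omega⟩
      have h := (plaqSmall_iter_descendTo_iff F hn i (θ (n - i)) U).mp (hD i (by omega))
      rw [show K - (K - n + i) = n - i by omega]
      exact h

/-- Set form: `histGood K 0 = D_{n,K}⁻¹(histGood n 0) ∩ histGood K n`. [cite: Balaban1985UV3, (7) p.257] -/
theorem histGood_zero_eq_preimage_inter (θ : ℕ → ℝ) :
    (histGood F ℰp θ K 0 : Set (GaugeField (F.P K) 0 (Matrix.specialUnitaryGroup (Fin 2) ℂ))) =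
      descendTo F ℰp n K hn ⁻¹' histGood F ℰp θ n 0 ∩ histGood F ℰp θ K n := by
  ext U
  rw [mem_histGood_zero_iff F hn θ U, Set.mem_inter_iff, Set.mem_preimage, and_comm]

/-! ## §2 The descended restricted measure of the all-heights event is a RESTRICTION downstairs -/

/-- **`(D_{n,K})_*(μ|histGood K 0) = ((D_{n,K})_*(μ|histGood K n))|histGood n 0`** for every measure `μ` on run `K`'s fine fields (in
particular its Gibbs measure): descending the fully-constrained restriction = restricting the descended `n`-free restriction to the
all-heights event of the `n`-th approximation. [cite: Balaban1985UV3, (7) p.257] -/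
theorem restrict_map_descendTo_histGood (θ : ℕ → ℝ) (μ : Measure (GaugeField (F.P K) 0 (Matrix.specialUnitaryGroup (Fin 2) ℂ))) :
    (Measure.map (descendTo F ℰp n K hn) (μ.restrict (histGood F ℰp θ K n))).restrict (histGood F ℰp θ n 0) =
      Measure.map (descendTo F ℰp n K hn) (μ.restrict (histGood F ℰp θ K 0)) := by
  rw [Measure.restrict_map (measurable_descendTo F ℰp measurableE_ℰp hn) (measurableSet_histGood F ℰp measurableE_ℰp θ n 0),
    Measure.restrict_restrict ((measurableSet_histGood F ℰp measurableE_ℰp θ n 0).preimage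
      (measurable_descendTo F ℰp measurableE_ℰp hn)),
    ← histGood_zero_eq_preimage_inter F hn θ]

end Events

/-! ## §3 Tilts restrict -/

section Restrict

variable {X : Type*} [MeasurableSpace X]

/-- **A TILT RESTRICTS TO EVERY MEASURABLE EVENT** with the same radius (and constant): `ν = C·e^{h}·μ ⇒ ν|E = C·e^{h}·(μ|E)`.
[cite: King1986, Thm 3.4 (3.9) p.656] -/
theorem isTilt_restrict {μ ν : Measure X} {r : ℝ} (ht : IsTilt μ ν r) {E : Set X} (hE : MeasurableSet E) :
    IsTilt (μ.restrict E) (ν.restrict E) r := by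
  obtain ⟨hr, h, C, hm, hC, hb, hν⟩ := ht
  exact ⟨hr, h, C, hm, hC, hb, by rw [hν, restrict_withDensity hE]⟩

end Restrict

/-! ## §4 r2 from the descended tilt at any comparison height; from `HeightSandwichAt` at any `m`; from UST's K1 pair -/

section Descended

variable (F : T3Family) {γ : ℝ} (hγ : 0 ≤ γ)

include hγ

/-- **THE FULLY-CONSTRAINED UNIT TILT ⇐ A DESCENDED TWO-RUN TILT AT ANY COMPARISON HEIGHT** (`n ≤ K` free top steps, threshold profile
`θ`, radius `r`): restrict the descended tilt to the all-heights event of the `n`-th approximation (§3, §2) and apply the `n` common free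
averagings (`isTilt_unitA_of_isTilt_descendTo`). [cite: King1986, Thm 3.4 (3.9) p.656 and Thm 2.1 p.654] -/
theorem isTilt_unitA_histGood_zero_of_descendedTilt (θ : ℕ → ℝ) {n K : ℕ} (hn : n ≤ K) {r : ℝ}
    (h : IsTilt (Measure.map (descendTo F ℰp n K hn) ((gibbsK F ℰp γ K).restrict (histGood F ℰp θ K n)))
      (Measure.map (descendTo F ℰp n (K + 1) (hn.trans (Nat.le_succ K)))
        ((gibbsK F ℰp γ (K + 1)).restrict (histGood F ℰp θ (K + 1) n))) r) :
    IsTilt (Measure.map (unitA F ℰp K) ((gibbsK F ℰp γ K).restrict (histGood F ℰp θ K 0)))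
      (Measure.map (unitA F ℰp (K + 1)) ((gibbsK F ℰp γ (K + 1)).restrict (histGood F ℰp θ (K + 1) 0))) r := by
  have h' := isTilt_restrict h (measurableSet_histGood F ℰp measurableE_ℰp θ n 0)
  rw [restrict_map_descendTo_histGood F hn θ, restrict_map_descendTo_histGood F (hn.trans (Nat.le_succ K)) θ] at h'
  exact isTilt_unitA_of_isTilt_descendTo F ℰp measurableE_ℰp hγ hn _ _ h'

/-- **`HeightSandwichAt F γ b₀ p₀ m → UnitTiltAt F γ b₀ p₀ 0` FOR EVERY `m`** (same radii): route `UnitScaleTilt`'s K1 estimate in the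
density currency at ANY free top fraction `1/m` gives route `SmallFieldWidening`'s all-heights unit tilt.  (`isTilt_descendTo_of_sandwich_ae`
per `K` at `n = ⌊K/m⌋`, then `isTilt_unitA_histGood_zero_of_descendedTilt`; `K / 0 = 0`.) [cite: King1986, Thm 3.4 (3.9)-(3.13) p.656] -/
theorem unitTiltAt_zero_of_heightSandwichAt {b₀ p₀ : ℝ} {m : ℕ} (h : HeightSandwichAt F γ b₀ p₀ m) :
    UnitTiltAt F γ b₀ p₀ 0 := by
  obtain ⟨r, c, hr, hr0, hc, hs⟩ := h
  refine ⟨r, hr, fun K => ?_⟩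
  have hdesc := isTilt_descendTo_of_sandwich_ae F hγ (Nat.div_le_self K m)
    (measurableSet_histGood F ℰp measurableE_ℰp (θBal F.L γ b₀ p₀) K (K / m))
    (measurableSet_histGood F ℰp measurableE_ℰp (θBal F.L γ b₀ p₀) (K + 1) (K / m)) (hr0 K) (hc K) (hs K)
  have ht := isTilt_unitA_histGood_zero_of_descendedTilt F hγ (θBal F.L γ b₀ p₀) (Nat.div_le_self K m) hdesc
  simpa only [Nat.div_zero] using ht

end Descended

/-- **r2 `AllHeightsSmallTilt` ⇐ `HeightSandwichAt` AT ANY (profile-dependent) FREE TOP FRACTION** under the route prefix.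
[cite: King1986, Thm 3.4 (3.9)-(3.13) p.656] -/
theorem allHeightsSmallTilt_of_heightSandwichAt_any
    (h : ∀ (L : ℕ) (b₀ p₀ : ℝ), 0 < b₀ → 2 < p₀ → ∃ (m : ℕ) (γ₁ : ℝ), 0 < γ₁ ∧
      ∀ (F : T3Family) (γ : ℝ), F.L = L → 0 < γ → γ ≤ γ₁ → HeightSandwichAt F γ b₀ p₀ m) :
    Summit.QuantumFields.YangMills.Theses.SmallFieldWidening.AllHeightsSmallTilt := by
  intro L b₀ p₀ hb₀ hp₀
  obtain ⟨m, γ₁, hγ₁, H⟩ := h L b₀ p₀ hb₀ hp₀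
  exact ⟨γ₁, hγ₁, fun F γ hFL hγ hle => unitTiltAt_zero_of_heightSandwichAt F hγ.le (H F γ hFL hγ hle)⟩

/-- **r2 ⇐ ROUTE `UnitScaleTilt`'S K1 PAIR, BY NAME**: `MinimiserStabilityRegPr` (K1aR-pr, stmt-QuantumFields-19200) and
`FluctuationComparisonRegPr` (K1bR-pr, stmt-QuantumFields-19201; all profiles) imply `AllHeightsSmallTilt` (stmt-QuantumFields-22883):
common `ε₀ := min ε₁ ε₁'`, `m := max m₀ m₀'`, `γ₁ := min γ₁ γ₁'`; the twins give `HeightSandwichAt F γ b₀ p₀ m`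
(`heightSandwich_unitTilt_of_regPr`), whence the all-heights tilt (`unitTiltAt_zero_of_heightSandwichAt`).  So crux r2 of route
`SmallFieldWidening` is DOWNSTREAM of route `UnitScaleTilt`'s K1 items, as its r3 is of the K2-L socket. [cite: King1986, Thm 3.4 (3.9)-(3.13) p.656] -/
theorem allHeightsSmallTilt_of_unitScaleTilt_regPr
    (h₁ : Summit.QuantumFields.YangMills.Theses.UnitScaleTilt.MinimiserStabilityRegPr)
    (h₂ : Summit.QuantumFields.YangMills.Theses.UnitScaleTilt.FluctuationComparisonRegPr) :
    Summit.QuantumFields.YangMills.Theses.SmallFieldWidening.AllHeightsSmallTilt := by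
  intro L b₀ p₀ hb₀ hp₀
  obtain ⟨ε₁, hε₁, H₁⟩ := h₁ L
  obtain ⟨ε₁', hε₁', H₂⟩ := h₂ L
  obtain ⟨m₁, hm₁⟩ := H₁ (min ε₁ ε₁') (lt_min hε₁ hε₁') (min_le_left _ _)
  obtain ⟨m₂, hm₂⟩ := H₂ (min ε₁ ε₁') (lt_min hε₁ hε₁') (min_le_right _ _)
  obtain ⟨γ₁, hγ₁, hA⟩ := hm₁ (max m₁ m₂) (le_max_left _ _) b₀ p₀ hb₀ hp₀
  obtain ⟨γ₂, hγ₂, hB⟩ := hm₂ (max m₁ m₂) (le_max_right _ _) b₀ p₀ hb₀ hp₀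
  refine ⟨min γ₁ γ₂, lt_min hγ₁ hγ₂, fun F γ hFL hγ hle => ?_⟩
  have hst := hA F γ hFL hγ (hle.trans (min_le_left _ _))
  have hfl := hB F γ hFL hγ (hle.trans (min_le_right _ _))
  exact unitTiltAt_zero_of_heightSandwichAt F hγ.le (heightSandwich_unitTilt_of_regPr hγ.le hst hfl).1

/-! ## §5 (appended) The mechanism in generic form: a descended tilt survives intersecting BOTH events with the pull-back of ANY
measurable downstairs event — the shape a repaired r2 with mixed windows (interior window at the comparison height, as in route
`UnitScaleTilt`'s K1b-INT stmt-QuantumFields-20520, full profile elsewhere) would consume -/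

section Generic

variable (F : T3Family) {γ : ℝ} (hγ : 0 ≤ γ) {n K : ℕ} (hn : n ≤ K)
  (S₀ : Set (GaugeField (F.P K) 0 (Matrix.specialUnitaryGroup (Fin 2) ℂ)))
  (S₁ : Set (GaugeField (F.P (K + 1)) 0 (Matrix.specialUnitaryGroup (Fin 2) ℂ)))
  {E : Set (GaugeField (F.P n) 0 (Matrix.specialUnitaryGroup (Fin 2) ℂ))}

/-- `(D_{n,K})_*(μ|(S ∩ D_{n,K}⁻¹E)) = ((D_{n,K})_*(μ|S))|E` for every measure `μ` on run `K`'s fine fields and measurable downstairs `E`.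
[cite: Balaban1987RG1, (0.11) p.253] -/
theorem map_descendTo_restrict_inter_preimage (hE : MeasurableSet E)
    (μ : Measure (GaugeField (F.P K) 0 (Matrix.specialUnitaryGroup (Fin 2) ℂ))) :
    Measure.map (descendTo F ℰp n K hn) (μ.restrict (S₀ ∩ descendTo F ℰp n K hn ⁻¹' E)) =
      (Measure.map (descendTo F ℰp n K hn) (μ.restrict S₀)).restrict E := by
  rw [Measure.restrict_map (measurable_descendTo F ℰp measurableE_ℰp hn) hE,
    Measure.restrict_restrict (hE.preimage (measurable_descendTo F ℰp measurableE_ℰp hn)), Set.inter_comm]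

include hγ in
/-- **A DESCENDED TWO-RUN TILT SURVIVES INTERSECTION WITH THE PULL-BACK OF ANY DOWNSTAIRS EVENT**: if the run-`K` and run-`(K+1)`
Gibbs measures restricted to `S₀`, `S₁` and descended to the `n`-th tower are tilts of each other with radius `r`, then so are the
UNIT-LATTICE push-forwards of their restrictions to `S₀ ∩ D_{n,K}⁻¹E`, `S₁ ∩ D_{n,K+1}⁻¹E` for every measurable event `E` of the `n`-th
tower's finest fields (§3 restriction + `T3TiltDescent.isTilt_unitA_of_isTilt_descendTo`).  With `S = histGood · n`, `E = histGood n 0`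
this is `isTilt_unitA_histGood_zero_of_descendedTilt`; with UST's interior events it is the engine of a mixed-window all-heights tilt.
[cite: King1986, Thm 3.4 (3.9) p.656 and Thm 2.1 p.654] -/
theorem isTilt_unitA_inter_preimage_of_descendedTilt (hE : MeasurableSet E) {r : ℝ}
    (h : IsTilt (Measure.map (descendTo F ℰp n K hn) ((gibbsK F ℰp γ K).restrict S₀))
      (Measure.map (descendTo F ℰp n (K + 1) (hn.trans (Nat.le_succ K))) ((gibbsK F ℰp γ (K + 1)).restrict S₁)) r) :
    IsTilt (Measure.map (unitA F ℰp K) ((gibbsK F ℰp γ K).restrict (S₀ ∩ descendTo F ℰp n K hn ⁻¹' E)))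
      (Measure.map (unitA F ℰp (K + 1))
        ((gibbsK F ℰp γ (K + 1)).restrict (S₁ ∩ descendTo F ℰp n (K + 1) (hn.trans (Nat.le_succ K)) ⁻¹' E))) r := by
  have h' := isTilt_restrict h hE
  rw [← map_descendTo_restrict_inter_preimage F hn S₀ hE, ← map_descendTo_restrict_inter_preimage F _ S₁ hE] at h'
  exact isTilt_unitA_of_isTilt_descendTo F ℰp measurableE_ℰp hγ hn _ _ h'

end Generic

end Summit.QuantumFields.YangMills.Theorems.AllHeightsSmallTilt

end
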